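import Mathlib
import HarnessLib
import Literature.MathematicalPhysics.QuantumLattice.GrassmannGaussConvKernelBound
import Summits.HubbardSuperconductivity.HubbardSuperconductivity.Theorems.KLProgrammeKLRegimeWickCrossIterate
import Summits.HubbardSuperconductivity.HubbardSuperconductivity.Theorems.KLProgrammeKLRegimeWickKernelAntisymm
import Summits.HubbardSuperconductivity.HubbardSuperconductivity.Theorems.KLProgrammeKLRegimeWickCrossContractionIterate

/-!
# Route `KLProgramme` — crux K3, ENGINE child (stmt-HubbardSuperconductivity-19918 / gen-6 successor), `stub_engine_step_values` (E2-v9):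
# the KERNELS OF A TWO-COPY PRODUCT `dblCopy 0 A · dblCopy 1 B` at an ARBITRARY interleaving of the copies
# (cell gate-hubbard-kl, seat p5 g4; E2-WICK-ROADMAP §5 (iv), HOME/prover-p5/E5-GAIN-SCALE-N.md (S2)/(S3b))

The `k`-line two-vertex terms of the Wick step are `Σ_{X,Y} (∏ contr C_i (X i) (Y i)) • dblFold((ι^[k]∂_X a)⁰ · (∂_Y b)¹)`
(`…WickCrossContractionIterate.crossLaplacian_listProd_copy_mul_copy`, p502489), and `kernel (dblFold F) m Z = Σ_s kernel F m (Z, s)`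
(`kernel_dblFold`, p485455) reads each leg of the output in either copy.  To turn these into the size functions of the sectorised bound
(`Literature/…/SectorisedCrossContractionBound`, p503622) one needs the kernel of a two-copy product `A⁰·B¹` at a doubled label tuple
`Z̃ : Fin m → Γ × Fin 2` in ANY order of the copies — p485455's block product rule covers the sorted order only.  Here:

* `iterDeriv_append` — `∂_{Fin.append Y X} = ∂_X ∘ ∂_Y` (the labels of `Y` are differentiated first);
* **`kernel_copy_mul_copy_block`** — block form, EXACT: for `X : Fin m₀ → Γ`, `Y : Fin m₁ → Γ`,
  `kernel (A⁰·B¹) (m₁+m₀) (append Ỹ X̃) = (−1)^{m₀m₁} · (m₀! m₁!/(m₁+m₀)!) · kernel A m₀ X · kernel B m₁ Y` (`X̃ j = (X j, 0)`, `Ỹ j = (Y j, 1)`);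
* **`norm_kernel_copy_mul_copy_of_perm`** — ANY interleaving: if `Z̃ ∘ σ = append Ỹ X̃` for a permutation `σ`, then
  `‖kernel (A⁰·B¹) (m₁+m₀) Z̃‖ = (m₀! m₁!/(m₁+m₀)!) · ‖kernel A m₀ X‖ · ‖kernel B m₁ Y‖` (antisymmetry `kernel_comp_perm`, p487966);
* **`exists_perm_block`** — every doubled tuple IS such an interleaving: for `Z̃ : Fin m → Γ × Fin 2` there are `m₀ + m₁ = m`, a cast, a
  permutation and `X, Y` with `Z̃ ∘ σ = append Ỹ X̃` (sorting the legs by copy; `Equiv.sumCompl`), whence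
  **`norm_kernel_copy_mul_copy`**: `‖kernel (A⁰·B¹) m Z̃‖ = (m₀! m₁!/m!) ‖kernel A m₀ X‖ ‖kernel B m₁ Y‖` for the data it produces;
* `factorial_mul_kernel_iterDeriv` (`m₀!·kernel (∂_X a) m₀ X₀ = (k+m₀)!·kernel a (k+m₀) (append X X₀)`), `kernel_involute_iterate`
  (`kernel (ι^[k] c) = (−1)^{mk} kernel c`), `norm_kernel_involute_iterDeriv`;
* **`norm_kernel_crossContract_le`** — THE BRIDGE: for covariances `C₀,…,C_{k−1}` and the sorting data of the doubled output tuple,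
  `‖kernel ((Δ_×(C_{k−1})∘⋯∘Δ_×(C_0))(a⁰·b¹)) m Z̃‖ ≤ ((k+m₀)!(k+m₁)!/m!) Σ_{X,Y} (∏_i ‖contr C_i (X i) (Y i)‖) ‖kernel a (k+m₀) (append X X₀)‖ ‖kernel b (k+m₁) (append Y Y₁)‖`
  — exactly the size-function form `Q(Z₀,Z₁) = Σ_{X,Y} (∏ L_i) Ka(X;Z₀) Kb(Y;Z₁)` of `Literature/…/SectorisedCrossContractionBound.sum_crossContraction_le`;
  `norm_kernel_dblFold_le` (`‖kernel (dblFold F) m Z‖ ≤ Σ_s ‖kernel F m (Z,s)‖`).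

Generic (`𝕜`-coefficients for the norm statements, any commutative `ℚ`-algebra for the exact one); no definitions; nothing about the model.

References: J. Feldman, H. Knörrer, E. Trubowitz, *Fermionic Functional Integrals and the Renormalization Group* (AMS 2002), §I.4; M. Salmhofer,
*Renormalization* (1999), §4.3 (4.95) (antisymmetric coefficient functions); cell files HOME/p1/E2-WICK-ROADMAP.md, HOME/prover-p5/E5-GAIN-SCALE-N.md.
-/

noncomputable section

namespace Summit.HubbardSuperconductivity.HubbardSuperconductivity.Theorems.KLRegimeWick

set_option linter.dupNamespace false -- summit = problem name (single-conjunct summit), D-0017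

open Literature.MathematicalPhysics.QuantumLattice GrassmannAlgebra Finset Matrix

section Exact

variable (R : Type*) [CommRing R] [Algebra ℚ R] {Γ : Type*} [Fintype Γ] [DecidableEq Γ]

omit [Algebra ℚ R] [Fintype Γ] [DecidableEq Γ] in
/-- **`∂_{append Y X} = ∂_X ∘ ∂_Y`**: in `iterDeriv (Fin.append Y X)` the labels of `Y` (the first block) are differentiated first. [folklore] -/
theorem iterDeriv_append {Γ' : Type*} {m₁ : ℕ} (Y : Fin m₁ → Γ') :
    ∀ {m₀ : ℕ} (X : Fin m₀ → Γ') (W : GrassmannAlgebra R Γ'),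
      iterDeriv R (Fin.append Y X) W = iterDeriv R X (iterDeriv R Y W)
  | 0, X, W => by
    have hX : X = Fin.elim0 := funext fun i => i.elim0
    have h0 : iterDeriv R X (iterDeriv R Y W) = iterDeriv R Y W := by simp [iterDeriv, hX]
    rw [h0, hX, Fin.append_elim0]
    rfl
  | m₀ + 1, X, W => by
    rw [← Fin.snoc_init_self X, Fin.append_snoc, iterDeriv_snoc, iterDeriv_snoc, iterDeriv_append Y (Fin.init X) W]

/-- **Kernels of a two-copy product, block form (exact)**: for `X : Fin m₀ → Γ`, `Y : Fin m₁ → Γ` and all `A, B`,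
`kernel (dblCopy 0 A · dblCopy 1 B) (m₁ + m₀) (append Ỹ X̃) = (−1)^{m₀ m₁} (m₀! m₁!/(m₁+m₀)!) · kernel A m₀ X · kernel B m₁ Y`,
`Ỹ j = (Y j, 1)`, `X̃ j = (X j, 0)`. [folklore] -/
theorem kernel_copy_mul_copy_block {m₀ m₁ : ℕ} (X : Fin m₀ → Γ) (Y : Fin m₁ → Γ) (A B : GrassmannAlgebra R Γ) :
    kernel R (dblCopy R 0 A * dblCopy R 1 B) (m₁ + m₀)
        (Fin.append (fun j => (Y j, (1 : Fin 2))) (fun j => (X j, (0 : Fin 2)))) =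
      ((((m₁ + m₀).factorial : ℚ)⁻¹ * (m₀.factorial * m₁.factorial : ℚ)) • (1 : R)) *
        ((-1 : R) ^ (m₀ * m₁) * kernel R A m₀ X * kernel R B m₁ Y) := by
  rw [kernel_def, iterDeriv_append, constPart_iterDeriv_iterDeriv_copy_mul_copy, constPart_iterDeriv_eq_mul_kernel,
    constPart_iterDeriv_eq_mul_kernel]
  have h1 : ((m₀.factorial : R)) = ((m₀.factorial : ℚ)) • (1 : R) := by
    rw [Nat.cast_smul_eq_nsmul, Nat.smul_one_eq_cast]
  have h2 : ((m₁.factorial : R)) = ((m₁.factorial : ℚ)) • (1 : R) := by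
    rw [Nat.cast_smul_eq_nsmul, Nat.smul_one_eq_cast]
  rw [h1, h2]
  simp only [smul_mul_assoc, mul_smul_comm, one_mul, smul_smul]
  congr 1
  ring

end Exact

section Norms

variable {𝕜 : Type*} [RCLike 𝕜] {Γ : Type*} [Fintype Γ] [DecidableEq Γ]

/-- **Kernels of a two-copy product at ANY interleaving of the copies** (norm form): if the doubled tuple `Z̃` is a permutation of a block
tuple, `Z̃ ∘ σ = append Ỹ X̃`, then `‖kernel (A⁰·B¹) (m₁+m₀) Z̃‖ = (m₀! m₁!/(m₁+m₀)!) ‖kernel A m₀ X‖ ‖kernel B m₁ Y‖`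
(antisymmetry of the kernels costs only a sign). [folklore] -/
theorem norm_kernel_copy_mul_copy_of_perm {m₀ m₁ : ℕ} (X : Fin m₀ → Γ) (Y : Fin m₁ → Γ) (A B : GrassmannAlgebra 𝕜 Γ)
    (Z : Fin (m₁ + m₀) → Γ × Fin 2) (σ : Equiv.Perm (Fin (m₁ + m₀)))
    (hZ : Z ∘ σ = Fin.append (fun j => (Y j, (1 : Fin 2))) (fun j => (X j, (0 : Fin 2)))) :
    ‖kernel 𝕜 (dblCopy 𝕜 0 A * dblCopy 𝕜 1 B) (m₁ + m₀) Z‖ =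
      ((m₀.factorial * m₁.factorial : ℝ) / (m₁ + m₀).factorial) * (‖kernel 𝕜 A m₀ X‖ * ‖kernel 𝕜 B m₁ Y‖) := by
  have hperm := kernel_comp_perm 𝕜 (dblCopy 𝕜 0 A * dblCopy 𝕜 1 B) σ Z
  rw [hZ, kernel_copy_mul_copy_block] at hperm
  -- `‖sign σ · k‖ = ‖k‖`
  have hsign : ‖(((Equiv.Perm.sign σ : ℤ) : 𝕜))‖ = 1 := by
    rcases Int.units_eq_one_or (Equiv.Perm.sign σ) with h | h <;> simp [h]
  have hnorm : ‖kernel 𝕜 (dblCopy 𝕜 0 A * dblCopy 𝕜 1 B) (m₁ + m₀) Z‖ =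
      ‖(((Equiv.Perm.sign σ : ℤ) : 𝕜)) * kernel 𝕜 (dblCopy 𝕜 0 A * dblCopy 𝕜 1 B) (m₁ + m₀) Z‖ := by
    rw [norm_mul, hsign, one_mul]
  rw [hnorm, ← hperm]
  have hfac : (0 : ℝ) < ((m₁ + m₀).factorial : ℝ) := by exact_mod_cast Nat.factorial_pos _
  simp only [norm_mul, norm_pow, norm_neg, norm_one, one_pow, one_mul, Algebra.smul_def, mul_one, map_mul, map_inv₀,
    map_natCast, norm_inv, RCLike.norm_natCast]
  rw [div_eq_inv_mul]

omit [Fintype Γ] [DecidableEq Γ] in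
/-- **Sorting a doubled tuple by copy**: every `Z̃ : Fin m → Γ × Fin 2` is, after a cast `m = m₁ + m₀` and a permutation, a block tuple
`append Ỹ X̃` — `m₁` legs in copy `1` followed by `m₀` legs in copy `0`. [folklore] -/
theorem exists_perm_block {m : ℕ} (Z : Fin m → Γ × Fin 2) :
    ∃ (m₀ m₁ : ℕ) (h : m = m₁ + m₀) (σ : Equiv.Perm (Fin (m₁ + m₀))) (X : Fin m₀ → Γ) (Y : Fin m₁ → Γ),
      (Z ∘ Fin.cast h.symm) ∘ σ = Fin.append (fun j => (Y j, (1 : Fin 2))) (fun j => (X j, (0 : Fin 2))) := by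
  classical
  -- the legs in copy 1 and their complement
  set p : Fin m → Prop := fun i => (Z i).2 = 1 with hp
  set m₁ := Fintype.card {i // p i} with hm₁
  set m₀ := Fintype.card {i // ¬p i} with hm₀
  have hcard : m = m₁ + m₀ := by
    rw [hm₁, hm₀, Fintype.card_subtype_compl, ← Nat.add_sub_assoc (Fintype.card_subtype_le _), Nat.add_sub_cancel_left,
      Fintype.card_fin]
  -- `Fin m₁ ⊕ Fin m₀ ≃ {p} ⊕ {¬p} ≃ Fin m`
  set e₁ : Fin m₁ ≃ {i // p i} := (Fintype.equivFin {i // p i}).symm with he₁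
  set e₀ : Fin m₀ ≃ {i // ¬p i} := (Fintype.equivFin {i // ¬p i}).symm with he₀
  set τ : Fin (m₁ + m₀) ≃ Fin m := finSumFinEquiv.symm.trans ((e₁.sumCongr e₀).trans (Equiv.sumCompl p)) with hτ
  refine ⟨m₀, m₁, hcard, τ.trans (finCongr hcard), fun j => (Z (e₀ j : Fin m)).1, fun j => (Z (e₁ j : Fin m)).1, ?_⟩
  funext i
  have hcc : ∀ x : Fin m, Fin.cast hcard.symm (Fin.cast hcard x) = x := fun x => Fin.ext rfl
  simp only [Function.comp_apply, Equiv.trans_apply, finCongr_apply, hcc]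
  refine Fin.addCases (fun j => ?_) (fun j => ?_) i
  · -- first block: copy 1
    have hτj : τ (Fin.castAdd m₀ j) = (e₁ j : Fin m) := by
      simp [hτ, finSumFinEquiv_symm_apply_castAdd, Equiv.sumCompl_apply_inl]
    rw [hτj, Fin.append_left]
    have h2 : (Z (e₁ j : Fin m)).2 = 1 := (e₁ j).2
    exact Prod.ext rfl h2
  · -- second block: copy 0
    have hτj : τ (Fin.natAdd m₁ j) = (e₀ j : Fin m) := by
      simp [hτ, finSumFinEquiv_symm_apply_natAdd, Equiv.sumCompl_apply_inr]
    rw [hτj, Fin.append_right]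
    have h2 : (Z (e₀ j : Fin m)).2 = 0 := by
      have hne : (Z (e₀ j : Fin m)).2 ≠ 1 := (e₀ j).2
      omega
    exact Prod.ext rfl h2

/-- Casting the degree index does not change a kernel. [folklore] -/
theorem kernel_comp_cast {R : Type*} [CommRing R] [Algebra ℚ R] {Γ' : Type*} (F : GrassmannAlgebra R Γ') {m m' : ℕ} (h : m = m')
    (Z : Fin m → Γ') : kernel R F m Z = kernel R F m' (Z ∘ Fin.cast h.symm) := by
  subst h
  rfl

/-- **Kernels of a two-copy product at an arbitrary doubled tuple** (norm form): with the sorting data of `exists_perm_block`,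
`‖kernel (A⁰·B¹) m Z̃‖ = (m₀! m₁!/m!) · ‖kernel A m₀ X‖ · ‖kernel B m₁ Y‖` — the `m₀` legs of `Z̃` in copy `0` are read by `A`, the `m₁` legs
in copy `1` by `B`, in any order. [folklore] -/
theorem norm_kernel_copy_mul_copy {m : ℕ} (A B : GrassmannAlgebra 𝕜 Γ) (Z : Fin m → Γ × Fin 2) {m₀ m₁ : ℕ} (h : m = m₁ + m₀)
    (σ : Equiv.Perm (Fin (m₁ + m₀))) (X : Fin m₀ → Γ) (Y : Fin m₁ → Γ)
    (hZ : (Z ∘ Fin.cast h.symm) ∘ σ = Fin.append (fun j => (Y j, (1 : Fin 2))) (fun j => (X j, (0 : Fin 2)))) :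
    ‖kernel 𝕜 (dblCopy 𝕜 0 A * dblCopy 𝕜 1 B) m Z‖ =
      ((m₀.factorial * m₁.factorial : ℝ) / m.factorial) * (‖kernel 𝕜 A m₀ X‖ * ‖kernel 𝕜 B m₁ Y‖) := by
  rw [kernel_comp_cast (dblCopy 𝕜 0 A * dblCopy 𝕜 1 B) h Z, norm_kernel_copy_mul_copy_of_perm X Y A B _ σ hZ, h]

/-! ## The `k`-line two-vertex term read in kernels -/

omit [Fintype Γ] [DecidableEq Γ] in
/-- **Kernels of an iterated derivative**: `m₀! · kernel (∂_X a) m₀ X₀ = (k+m₀)! · kernel a (k+m₀) (append X X₀)` — the `k` contracted labels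
`X` are differentiated first, then the `m₀` free ones. [folklore] -/
theorem factorial_mul_kernel_iterDeriv {R : Type*} [CommRing R] [Algebra ℚ R] {Γ' : Type*} {k m₀ : ℕ} (X : Fin k → Γ') (X₀ : Fin m₀ → Γ')
    (a : GrassmannAlgebra R Γ') :
    (m₀.factorial : R) * kernel R (iterDeriv R X a) m₀ X₀ = ((k + m₀).factorial : R) * kernel R a (k + m₀) (Fin.append X X₀) := by
  rw [← constPart_iterDeriv_eq_mul_kernel, ← iterDeriv_append, constPart_iterDeriv_eq_mul_kernel]

omit [Fintype Γ] [DecidableEq Γ] in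
/-- **Kernels through iterated involutions**: `kernel (ι^[k] c) m X = (−1)^{m k} · kernel c m X`. [folklore] -/
theorem kernel_involute_iterate {R : Type*} [CommRing R] [Algebra ℚ R] {Γ' : Type*} (k : ℕ) {m : ℕ} (X : Fin m → Γ')
    (c : GrassmannAlgebra R Γ') :
    kernel R (CliffordAlgebra.involute^[k] c) m X = (-1 : R) ^ (m * k) * kernel R c m X := by
  induction k generalizing c with
  | zero => simp
  | succ k ih =>
    rw [Function.iterate_succ_apply', kernel_def, iterDeriv_involute, map_smul, constPart_involute, smul_eq_mul, ← mul_assoc,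
      mul_comm _ ((-1 : R) ^ m), mul_assoc, ← kernel_def, ih, ← mul_assoc, ← pow_add, Nat.mul_succ, add_comm]

omit [Fintype Γ] [DecidableEq Γ] in
/-- The norm version: `‖kernel (ι^[k] c) m X‖ = ‖kernel c m X‖`. [folklore] -/
theorem norm_kernel_involute_iterate (k : ℕ) {m : ℕ} (X : Fin m → Γ) (c : GrassmannAlgebra 𝕜 Γ) :
    ‖kernel 𝕜 (CliffordAlgebra.involute^[k] c) m X‖ = ‖kernel 𝕜 c m X‖ := by
  rw [kernel_involute_iterate, norm_mul, norm_pow, norm_neg, norm_one, one_pow, one_mul]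

omit [Fintype Γ] [DecidableEq Γ] in
/-- The norm of the kernels of an iterated derivative: `‖kernel (ι^[j] (∂_X a)) m₀ X₀‖ = ((k+m₀)!/m₀!) ‖kernel a (k+m₀) (append X X₀)‖`. [folklore] -/
theorem norm_kernel_involute_iterDeriv (j : ℕ) {k m₀ : ℕ} (X : Fin k → Γ) (X₀ : Fin m₀ → Γ) (a : GrassmannAlgebra 𝕜 Γ) :
    ‖kernel 𝕜 (CliffordAlgebra.involute^[j] (iterDeriv 𝕜 X a)) m₀ X₀‖ =
      ((k + m₀).factorial : ℝ) * ‖kernel 𝕜 a (k + m₀) (Fin.append X X₀)‖ / m₀.factorial := by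
  have hm : (0 : ℝ) < m₀.factorial := by exact_mod_cast Nat.factorial_pos m₀
  have h := congrArg norm (factorial_mul_kernel_iterDeriv (R := 𝕜) X X₀ a)
  rw [norm_mul, norm_mul, RCLike.norm_natCast, RCLike.norm_natCast] at h
  rw [norm_kernel_involute_iterate, eq_div_iff hm.ne', mul_comm]
  exact h

/-- **The `k`-line two-vertex term at one colouring of the output legs** (the bridge from p502489 to p503622's size functions):
for covariances `C₀ … C_{k−1}`, the doubled output tuple `Z̃` sorted by copy as `Z̃ ∘ cast ∘ σ = append Ỹ₁ X̃₀` (`m₀` legs of `a`,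
`m₁` legs of `b`, data from `exists_perm_block`),
`‖kernel ((Δ_×(C_{k−1})∘⋯∘Δ_×(C_0))(a⁰·b¹)) m Z̃‖ ≤ ((k+m₀)!(k+m₁)!/m!) · Σ_{X,Y : Fin k → Γ} (∏_i ‖contr C_i (X i) (Y i)‖) ·
‖kernel a (k+m₀) (append X X₀)‖ · ‖kernel b (k+m₁) (append Y Y₁)‖` — `a` read on its `k` contracted legs followed by its free legs,
`b` likewise. [cite: FeldmanKnorrerTrubowitz2002, §I.4] -/
theorem norm_kernel_crossContract_le {k m : ℕ} (C : Fin k → Matrix Γ Γ 𝕜) (a b : GrassmannAlgebra 𝕜 Γ) (Z : Fin m → Γ × Fin 2)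
    {m₀ m₁ : ℕ} (h : m = m₁ + m₀) (σ : Equiv.Perm (Fin (m₁ + m₀))) (X₀ : Fin m₀ → Γ) (Y₁ : Fin m₁ → Γ)
    (hZ : (Z ∘ Fin.cast h.symm) ∘ σ = Fin.append (fun j => (Y₁ j, (1 : Fin 2))) (fun j => (X₀ j, (0 : Fin 2)))) :
    ‖kernel 𝕜 (((List.ofFn fun i => grassmannLaplacian 𝕜 (crossCov 𝕜 (C i))).reverse).prod (dblCopy 𝕜 0 a * dblCopy 𝕜 1 b)) m Z‖ ≤
      (((k + m₀).factorial * (k + m₁).factorial : ℝ) / m.factorial) *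
        ∑ X : Fin k → Γ, ∑ Y : Fin k → Γ, (∏ i, ‖contr 𝕜 (C i) (X i) (Y i)‖) *
          (‖kernel 𝕜 a (k + m₀) (Fin.append X X₀)‖ * ‖kernel 𝕜 b (k + m₁) (Fin.append Y Y₁)‖) := by
  have hm₀ : (0 : ℝ) < m₀.factorial := by exact_mod_cast Nat.factorial_pos m₀
  have hm₁ : (0 : ℝ) < m₁.factorial := by exact_mod_cast Nat.factorial_pos m₁
  have hm : (0 : ℝ) < m.factorial := by exact_mod_cast Nat.factorial_pos m
  rw [crossLaplacian_listProd_copy_mul_copy, kernel_smul, norm_mul, norm_pow, norm_neg, norm_one, one_pow, one_mul, kernel_sum]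
  refine (norm_sum_le _ _).trans ?_
  rw [Finset.mul_sum]
  refine Finset.sum_le_sum fun X _ => ?_
  rw [kernel_sum]
  refine (norm_sum_le _ _).trans ?_
  rw [Finset.mul_sum]
  refine Finset.sum_le_sum fun Y _ => le_of_eq ?_
  have hb : ‖kernel 𝕜 (iterDeriv 𝕜 Y b) m₁ Y₁‖ =
      ((k + m₁).factorial : ℝ) * ‖kernel 𝕜 b (k + m₁) (Fin.append Y Y₁)‖ / m₁.factorial := by
    have h0 := norm_kernel_involute_iterDeriv (𝕜 := 𝕜) 0 Y Y₁ b
    rwa [Function.iterate_zero, id_eq] at h0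
  rw [kernel_smul, norm_mul, norm_prod,
    norm_kernel_copy_mul_copy (CliffordAlgebra.involute^[k] (iterDeriv 𝕜 X a)) (iterDeriv 𝕜 Y b) Z h σ X₀ Y₁ hZ,
    norm_kernel_involute_iterDeriv, hb, h]
  field_simp

/-- **Folding**: the kernels of `dblFold F` are bounded by the sum over the colourings of the output legs,
`‖kernel (dblFold F) m Z‖ ≤ Σ_{s : Fin m → Fin 2} ‖kernel F m (Z, s)‖` (`kernel_dblFold`, p485455). [folklore] -/
theorem norm_kernel_dblFold_le (F : GrassmannAlgebra 𝕜 (Γ × Fin 2)) (m : ℕ) (Z : Fin m → Γ) :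
    ‖kernel 𝕜 (dblFold 𝕜 F) m Z‖ ≤ ∑ s : Fin m → Fin 2, ‖kernel 𝕜 F m (fun i => (Z i, s i))‖ := by
  rw [kernel_dblFold]
  exact norm_sum_le _ _

end Norms

end Summit.HubbardSuperconductivity.HubbardSuperconductivity.Theorems.KLRegimeWick

end
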